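import Mathlib
import Literature.MathematicalPhysics.QuantumFieldTheory.Luscher2010.TrivializingMaps
import Summits.Ventures.LatticeQCDFlow.TrivializingMaps.DefectLogWeight
import Summits.Ventures.LatticeQCDFlow.TrivializingMaps.LogWeightDensity
import HarnessLib

/-!
# Trivializing flows trivialize: Lüscher's §4.1–§4.2 theorem, modulo the cited §3 facts

HONEST FRAMING: exact (Metropolis-corrected) sampling algorithms for lattice gauge theory; figures of merit are
autocorrelation/cost numbers at stated couplings and volumes; no continuum-physics claim.

Lüscher §4.1: if the generator satisfies (4.3) then (4.1) holds and "the transformation at `t = 1` is then a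
trivializing map"; §4.2: with the ansatz `Z_t = -∂S̃_t` (4.4), (4.3) is the Laplace equation
`𝓛_t S̃_t = S + Ċ_t` (4.5), which is solvable (App. E) — "a constructive proof of the existence of
trivializing flows has thus been given". This file kernel-checks the LOGIC of that theorem on the finite
field manifold `SU(n)^E`, with the three analytic inputs kept as the cited named facts of the Literature
file (`FlowGlobalExistence` §3.1, `JacobianFormula` §3.2 eq. (3.9), `TrivializingFlowExists` §4.2/App. E):
* `isProbabilityMeasure_boltzmannMeasure`, `map_eq_boltzmann_of_density_le`: `𝒵⁻¹e^{-S}D[U]` is a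
  probability measure, and a pushforward of `D[V]` whose density w.r.t. it is constant IS it (the
  field-independent constant `C_1` of (4.2) drops out upon normalisation);
* `isTrivializingMap_of_flowEquation`: `FlowGlobalExistence → JacobianFormula →` an EXACT solution of
  (4.5) on `[0,1]`, integrated by `Φ`, makes `Φ_1` a trivializing map (`IsTrivializingMap`, transport form)
  — the `δ = 0` case of `DefectLogWeight(Measure).lean`;
* `exists_isTrivializingMap_flow`: adding `TrivializingFlowExists`, every smooth action has a trivializing
  map which is the time-one map of a jointly continuous gradient flow (then `⟨𝒪⟩ = ∫ D[V] 𝒪(Φ_1 V)`,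
  `IsTrivializingMap.integral_comp`).

References: M. Lüscher, Trivializing maps, the Wilson flow and the HMC algorithm, CMP 293 (2010) 899
[Luscher2010Trivializing, arXiv:0907.5491], §2.3 eqs. (2.7)–(2.9), §3.1–§3.2 eq. (3.9), §4.1 eqs.
(4.1)–(4.3), §4.2 eqs. (4.4)–(4.10), App. E.
-/

namespace Summit.Ventures.LatticeQCDFlow.TrivializingMaps

open MeasureTheory
open Literature.MathematicalPhysics.QuantumFieldTheory
open Literature.MathematicalPhysics.QuantumFieldTheory.Luscher2010
open scoped Matrix Matrix.Norms.Frobenius ContDiff ENNReal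

section Boltzmann

variable {d L n : ℕ} [NeZero L]

/-- `𝒵⁻¹ e^{-S} D[U]` is a probability measure for a continuous action on the compact field manifold
(`0 < 𝒵 < ∞`). [cite: Luscher2010Trivializing, §2.1 eq. (2.1)] -/
theorem isProbabilityMeasure_boltzmannMeasure
    {S : GaugeConfig d L (Matrix.specialUnitaryGroup (Fin n) ℂ) → ℝ} (hS : Continuous S) :
    IsProbabilityMeasure (boltzmannMeasure S) := by
  obtain ⟨hZ0, hZtop⟩ := partitionFn_ne_zero_and_ne_top (d := d) (L := L) hS
  refine ⟨?_⟩
  unfold boltzmannMeasure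
  rw [Measure.smul_apply, withDensity_apply _ MeasurableSet.univ, Measure.restrict_univ, smul_eq_mul]
  exact ENNReal.inv_mul_cancel hZ0 hZtop

/-- **Constant densities are trivial**: if `T_* D[V] = ρ · 𝒵⁻¹e^{-S}D[U]` with `ρ(U) ≤ ρ(U')` for ALL
`U, U'` (so `ρ` is constant), then `T_* D[V] = 𝒵⁻¹e^{-S}D[U]` — both sides are probability measures, so the
constant is `1`. This is the last step of §4.1 ("the transformation at `t = 1` is then a trivializing map":
a field-independent `C_t` drops out upon normalisation). [cite: Luscher2010Trivializing, §2.3 eq. (2.8), §4.1 eq. (4.2)] -/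
theorem map_eq_boltzmann_of_density_le
    {S : GaugeConfig d L (Matrix.specialUnitaryGroup (Fin n) ℂ) → ℝ} (hS : Continuous S)
    {T : GaugeConfig d L (Matrix.specialUnitaryGroup (Fin n) ℂ) →
      GaugeConfig d L (Matrix.specialUnitaryGroup (Fin n) ℂ)} (hT : Measurable T)
    {ρ : GaugeConfig d L (Matrix.specialUnitaryGroup (Fin n) ℂ) → ℝ}
    (hmap : Measure.map T (trivialMeasure (Matrix.specialUnitaryGroup (Fin n) ℂ) d L) =
      (boltzmannMeasure S).withDensity (fun U => ENNReal.ofReal (ρ U)))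
    (hle : ∀ U U', ρ U ≤ ρ U') :
    Measure.map T (trivialMeasure (Matrix.specialUnitaryGroup (Fin n) ℂ) d L) = boltzmannMeasure S := by
  haveI : IsProbabilityMeasure (trivialMeasure (Matrix.specialUnitaryGroup (Fin n) ℂ) d L) := by
    unfold trivialMeasure; infer_instance
  haveI := isProbabilityMeasure_boltzmannMeasure (d := d) (L := L) hS
  haveI := Measure.isProbabilityMeasure_map
    (μ := trivialMeasure (Matrix.specialUnitaryGroup (Fin n) ℂ) d L) hT.aemeasurable
  obtain ⟨U₀⟩ : Nonempty (GaugeConfig d L (Matrix.specialUnitaryGroup (Fin n) ℂ)) := inferInstance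
  have hconst : (fun U => ENNReal.ofReal (ρ U)) = fun _ => ENNReal.ofReal (ρ U₀) :=
    funext fun U => by rw [le_antisymm (hle U U₀) (hle U₀ U)]
  rw [hconst, withDensity_const] at hmap
  have h1 : ENNReal.ofReal (ρ U₀) = 1 := by
    have hmass := congrArg
      (fun μ : Measure (GaugeConfig d L (Matrix.specialUnitaryGroup (Fin n) ℂ)) => μ Set.univ) hmap
    simp only [Measure.smul_apply, measure_univ, smul_eq_mul, mul_one] at hmass
    exact hmass.symm
  rw [hmap, h1, one_smul]

end Boltzmann

section TrivializingFlow

variable {d L n : ℕ} [NeZero L]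

/-- **Trivializing flows trivialize** (§4.1–§4.2, modulo the two §3 facts `FlowGlobalExistence` and
`JacobianFormula`): if the flow action `S̃_t` solves Lüscher's equation `𝓛_t S̃_t = S + Ċ_t` (4.5) EXACTLY
on `[0,1] × SU(n)^E`, for some field-independent `Ċ`, and `Φ` integrates the gradient generator
`Z_t = -∂S̃_t` (4.4), then `Φ_1` is a trivializing map for `S` in the transport sense:
`(Φ_1)_* D[V] = 𝒵⁻¹ e^{-S} D[U]`. Proof: the defect is `0`, so by `DefectControlsLogWeight` (files G/H) the
density `ρ` of `(Φ_1)_* D[V]` w.r.t. the Boltzmann measure satisfies `ρ U ≤ e^0 ρ U'`, i.e. is constant, and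
a constant density between probability measures is `1`. [cite: Luscher2010Trivializing, §4.1 eqs. (4.1)–(4.3), §4.2 eqs. (4.4)–(4.6)] -/
theorem isTrivializingMap_of_flowEquation (hGE : FlowGlobalExistence d L n) (hJ : JacobianFormula d L n)
    (B : SuBasis n) {S : AmbConfig d L n → ℝ} (hS : ContDiff ℝ ∞ S)
    {F : ℝ → AmbConfig d L n → ℝ} (hF : ContDiff ℝ ∞ fun p : ℝ × AmbConfig d L n => F p.1 p.2)
    {Φ : ℝ → GaugeConfig d L (Matrix.specialUnitaryGroup (Fin n) ℂ) →
      GaugeConfig d L (Matrix.specialUnitaryGroup (Fin n) ℂ)}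
    (hΦ : IsFlowMap (fun t W => -linkGrad B (F t) W) Φ) (hmeas : Measurable (Φ 1)) {c : ℝ → ℝ}
    (hsol : ∀ t ∈ Set.Icc (0 : ℝ) 1, ∀ U : GaugeConfig d L (Matrix.specialUnitaryGroup (Fin n) ℂ),
      luscherL B S t (F t) (WilsonFlow.coeConfig U) = S (WilsonFlow.coeConfig U) + c t) :
    IsTrivializingMap
      (fun U : GaugeConfig d L (Matrix.specialUnitaryGroup (Fin n) ℂ) => S (WilsonFlow.coeConfig U))
      (Φ 1) := by
  have hδ : ∀ t ∈ Set.Icc (0 : ℝ) 1, ∀ U : GaugeConfig d L (Matrix.specialUnitaryGroup (Fin n) ℂ),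
      |luscherL B S t (F t) (WilsonFlow.coeConfig U) - S (WilsonFlow.coeConfig U) - c t| ≤ 0 :=
    fun t ht U => by
      rw [hsol t ht U, show S (WilsonFlow.coeConfig U) + c t - S (WilsonFlow.coeConfig U) - c t = 0 by ring,
        abs_zero]
  have hosc := fun V V' => logWeight_osc_le_of_defect B hS hF hΦ hδ V V'
  simp only [mul_zero] at hosc
  obtain ⟨ρ, -, -, hmap, hratio⟩ :=
    exists_density_of_logWeight_osc hGE hJ B hS hF hΦ hmeas (M := 0) hosc
  refine ⟨hmeas, map_eq_boltzmann_of_density_le ?_ hmeas hmap fun U U' => ?_⟩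
  · exact hS.continuous.comp WilsonFlow.continuous_coeConfig
  · have h := hratio U U'
    rwa [Real.exp_zero, one_mul] at h

/-- **Lüscher's existence theorem for trivializing maps, as a flow** (§4.2: "a constructive proof of the
existence of trivializing flows has thus been given"), kernel-checked MODULO the three cited analytic inputs
`TrivializingFlowExists` (solvability of (4.5), App. E), `FlowGlobalExistence` (§3.1) and `JacobianFormula`
(§3.2, eq. (3.9)): for every smooth action `S` there are a jointly smooth flow action `S̃` and a jointly
continuous flow `Φ` of `Z_t = -∂S̃_t` on `SU(n)^E` whose time-one map is trivializing,
`⟨𝒪⟩ = ∫ D[V] 𝒪(Φ_1(V))` (use `IsTrivializingMap.integral_comp`). [cite: Luscher2010Trivializing, §4.2 eqs. (4.4)–(4.10), App. E] -/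
theorem exists_isTrivializingMap_flow (hTF : TrivializingFlowExists d L n)
    (hGE : FlowGlobalExistence d L n) (hJ : JacobianFormula d L n) (B : SuBasis n)
    {S : AmbConfig d L n → ℝ} (hS : ContDiff ℝ ∞ S) :
    ∃ (F : ℝ → AmbConfig d L n → ℝ)
      (Φ : ℝ → GaugeConfig d L (Matrix.specialUnitaryGroup (Fin n) ℂ) →
        GaugeConfig d L (Matrix.specialUnitaryGroup (Fin n) ℂ)),
      ContDiff ℝ ∞ (fun p : ℝ × AmbConfig d L n => F p.1 p.2) ∧
      IsFlowMap (fun t W => -linkGrad B (F t) W) Φ ∧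
      Continuous (fun p : ℝ × GaugeConfig d L (Matrix.specialUnitaryGroup (Fin n) ℂ) => Φ p.1 p.2) ∧
      IsTrivializingMap
        (fun U : GaugeConfig d L (Matrix.specialUnitaryGroup (Fin n) ℂ) => S (WilsonFlow.coeConfig U))
        (Φ 1) := by
  haveI : SecondCountableTopology (Matrix (Fin n) (Fin n) ℂ) :=
    inferInstanceAs (SecondCountableTopology (Fin n → Fin n → ℂ))
  haveI : SecondCountableTopology (Matrix.specialUnitaryGroup (Fin n) ℂ) :=
    Topology.IsEmbedding.subtypeVal.secondCountableTopology
  obtain ⟨F, c, hF, -, hsol⟩ := hTF B S hS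
  obtain ⟨Φ, hΦ, hcont, -⟩ := hGE (fun t W => -linkGrad B (F t) W)
    (contDiff_one_neg_linkGrad_param B hF) (isTangent_neg_linkGrad B F)
  have hΦ1c : Continuous (Φ 1) := hcont.comp (continuous_const.prodMk continuous_id)
  exact ⟨F, Φ, hF, hΦ, hcont,
    isTrivializingMap_of_flowEquation hGE hJ B hS hF hΦ hΦ1c.measurable (c := c) fun t _ U => hsol t U⟩

end TrivializingFlow

end Summit.Ventures.LatticeQCDFlow.TrivializingMaps
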